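import Summits.HubbardSuperconductivity.HubbardSuperconductivity.Theorems.AnisotropyChordTransferFibre3OneLoop

/-!
# Route `AnisotropyChord` / H0 rotor rung: the one-loop identity layer of PartN31, part 2 — the GREEN-ZERO IDENTITY (`L ≥ 3`)

Memo ROTOR-THEORY-21 §297(A) (theory seat `hubbard-h0-rotor-theory-1`), typed as `GreenZeroIdentity` in `…Fibre3BetaFreeTargets`:
for a two-magnon eigenfunction (`IsTwoMagnon`, eigenvalue `0 < λ₂ < 2ε₁`)

  `(1/V) Σ_{k≠0} 1/(2ε(k) − λ₂) = 1/(Vλ₂) − Δ/(4(1−Δ) + Δλ₂)`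

(**`greenZeroIdentity_holds (hL : 3 ≤ L)`**).  Proof: Fourier inversion at the origin `Σ_k f̂(k) = V f(0) = 0`, the landed
`TwoMagnonFourier` (`(2ε(k) − λ₂) f̂(k) = −f(x̂)(4(1−Δ) + 2Δε(k))`, valid for `L ≥ 3`; at `k = 0` it is the sum rule
`λ₂V = 4(1−Δ)f(x̂)`), `ε(k) ≥ ε₁ > λ₂/2` off the origin, and the partial fraction `(4η + 2Δε)/(2ε − λ₂) = Δ + (4η + Δλ₂)/(2ε − λ₂)`.
The identity is FALSE at `L = 2` (e.g. `Δ = 1/2`), like `TwoMagnonFourier`; it holds vacuously at `L = 1`.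
Prover seat `hubbard-h0-rotor-p1` g22; helper for stmt-HubbardSuperconductivity-19089 (`--supports`).
-/

set_option linter.dupNamespace false
set_option autoImplicit false

noncomputable section

open scoped BigOperators
open Complex

namespace Summit.HubbardSuperconductivity.HubbardSuperconductivity.Theorems.AnisotropyChord.Transfer.Fibre3

variable (L : ℕ) [NeZero L]

/-- Fourier inversion at the origin: `Σ_k f̂(k) = V·f(0)`. [folklore] -/
theorem sum_dft (f : Tor L → ℝ) : ∑ k : Tor L, dft L f k = ((L : ℂ) ^ 2) * (f 0 : ℂ) := by
  unfold dft
  rw [Finset.sum_comm]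
  have : ∀ r : Tor L, ∑ k : Tor L, (starRingEnd ℂ) (phase L k r) * (f r : ℂ)
      = (if r = 0 then ((L : ℂ) ^ 2) else 0) * (f r : ℂ) := by
    intro r; rw [← Finset.sum_mul, sum_conj_phase_left]
  rw [Finset.sum_congr rfl fun r _ => this r]
  simp

/-- `f̂(0) = Σ_r f(r)`. [folklore] -/
theorem dft_zero (f : Tor L → ℝ) : dft L f 0 = ((∑ r : Tor L, f r : ℝ) : ℂ) := by
  unfold dft
  push_cast
  refine Finset.sum_congr rfl fun r _ => ?_
  rw [phase_zero_left, map_one, one_mul]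

omit [NeZero L] in
/-- `ε(0) = 0`. [folklore] -/
theorem epsT_zero : epsT L 0 = 0 := by
  unfold epsT
  simp only [Prod.fst_zero, Prod.snd_zero, ZMod.val_zero, Nat.cast_zero, mul_zero, zero_div, Real.cos_zero]
  ring

/-- `ε(k) ≥ ε₁` off the origin (`L ≥ 2`). [folklore] -/
theorem eps1_le_epsT (hL : 2 ≤ L) {k : Tor L} (hk : k ≠ 0) : eps1 L ≤ epsT L k := by
  have h := FreeGap.eps_ge_epsMin L hL k hk
  rw [freeGap_epsMin_eq, freeGap_eps_eq] at h
  exact h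

/-- **THE GREEN-ZERO IDENTITY holds for `L ≥ 3`.** [folklore] -/
theorem greenZeroIdentity_holds (hL : 3 ≤ L) (Δ lam2 : ℝ) : GreenZeroIdentity L Δ lam2 := by
  classical
  intro f hf hl0 hl2
  obtain ⟨h0, hnn, hpos, hsum, heq⟩ := hf
  have hL2 : 2 ≤ L := by omega
  set V : ℝ := (L : ℝ) ^ 2 with hV
  have hVpos : 0 < V := by
    have : (0 : ℝ) < L := by exact_mod_cast (show 0 < L by omega)
    positivity
  set fnn : ℝ := f (K1 L) with hfnn
  set A : ℝ := 4 * (1 - Δ) + Δ * lam2 with hA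
  set S₁ : ℝ := ∑ k ∈ (Finset.univ : Finset (Tor L)).erase 0, 1 / (2 * epsT L k - lam2) with hS₁
  have hF := twoMagnonFourier_holds L hL Δ lam2 f h0 hnn heq
  -- (a) the sum rule at k = 0: λ₂ V = 4(1−Δ) f(x̂)
  have E1 : lam2 * V = 4 * (1 - Δ) * fnn := by
    have h := hF 0
    rw [epsT_zero, dft_zero, hsum] at h
    have h' : (((2 * 0 - lam2) * V : ℝ) : ℂ) = (( -(f (K1 L) * (4 * (1 - Δ) + 2 * Δ * 0)) : ℝ) : ℂ) := by
      push_cast at h ⊢; linear_combination h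
    have h'' := Complex.ofReal_injective h'
    rw [hfnn]; linarith
  -- (b) the coefficients off the origin
  have hck : ∀ k : Tor L, k ≠ 0 → 0 < 2 * epsT L k - lam2 := by
    intro k hk; have := eps1_le_epsT L hL2 hk; linarith
  have hcoef : ∀ k : Tor L, k ≠ 0 → dft L f k = ((-(fnn * (Δ + A / (2 * epsT L k - lam2))) : ℝ) : ℂ) := by
    intro k hk
    have h := hF k
    have hc := hck k hk
    have hcC : ((2 * epsT L k - lam2 : ℝ) : ℂ) ≠ 0 := by exact_mod_cast hc.ne'
    have e : dft L f k = -((f (K1 L) * (4 * (1 - Δ) + 2 * Δ * epsT L k) : ℝ) : ℂ) / ((2 * epsT L k - lam2 : ℝ) : ℂ) := by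
      rw [eq_div_iff hcC, mul_comm]; exact h
    rw [e, ← hfnn, hA]
    rw [← Complex.ofReal_neg, ← Complex.ofReal_div]
    congr 1
    field_simp
    ring
  -- (c) Fourier inversion at the origin: V + Σ_{k≠0} f̂(k) = 0
  have hinv : V - fnn * (Δ * (V - 1) + A * S₁) = 0 := by
    have h := sum_dft L f
    rw [h0, Complex.ofReal_zero, mul_zero, ← Finset.sum_erase_add _ _ (Finset.mem_univ (0 : Tor L)), dft_zero, hsum]
      at h
    rw [Finset.sum_congr rfl fun k hk => hcoef k (Finset.ne_of_mem_erase hk)] at h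
    rw [← Complex.ofReal_sum, ← Complex.ofReal_add] at h
    have h' := Complex.ofReal_injective (h.trans Complex.ofReal_zero.symm)
    have hcard : (((Finset.univ : Finset (Tor L)).erase 0).card : ℝ) = V - 1 := by
      rw [Finset.card_erase_of_mem (Finset.mem_univ _), Finset.card_univ]
      have : Fintype.card (Tor L) = L ^ 2 := by
        rw [Fintype.card_prod, ZMod.card]; ring
      rw [this, Nat.cast_sub (Nat.one_le_pow _ _ (by omega))]
      push_cast; rw [hV]
    have hsplit : ∑ k ∈ (Finset.univ : Finset (Tor L)).erase 0, (-(fnn * (Δ + A / (2 * epsT L k - lam2))))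
        = -(fnn * (Δ * (V - 1) + A * S₁)) := by
      rw [hS₁, Finset.mul_sum, Finset.sum_neg_distrib]
      congr 1
      rw [← hcard, mul_add, Finset.mul_sum]
      have : fnn * (Δ * (((Finset.univ : Finset (Tor L)).erase 0).card : ℝ))
          = ∑ k ∈ (Finset.univ : Finset (Tor L)).erase 0, fnn * Δ := by
        rw [Finset.sum_const]; simp; ring
      rw [this, ← Finset.sum_add_distrib]
      refine Finset.sum_congr rfl fun k _ => ?_; ring
    rw [hsplit] at h'
    rw [hV] at h' ⊢
    linarith
  -- (d) A ≠ 0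
  have hfnn_pos : 0 < fnn := hpos
  have hη : 0 < 1 - Δ := by
    have : 0 < lam2 * V := mul_pos hl0 hVpos
    nlinarith
  have hA0 : A ≠ 0 := by
    intro hA0
    rw [hA0, zero_mul, add_zero] at hinv
    -- V = fnn Δ (V − 1) with Δ < 0
    have hΔ : Δ < 0 := by
      have : Δ * lam2 = -(4 * (1 - Δ)) := by rw [hA] at hA0; linarith
      nlinarith
    have hV1 : 0 ≤ V - 1 := by
      rw [hV]
      have : (1 : ℝ) ≤ L := by exact_mod_cast (show 1 ≤ L by omega)
      nlinarith
    nlinarith [mul_nonneg hfnn_pos.le hV1]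
  -- (e) algebra
  have key : lam2 * A * S₁ = A - Δ * V * lam2 := by
    have h3 : lam2 * V = lam2 * (fnn * (Δ * (V - 1) + A * S₁)) := by
      congr 1; linarith
    rw [E1] at h3
    have h4 : 4 * (1 - Δ) = lam2 * (Δ * (V - 1) + A * S₁) := by
      have := mul_right_cancel₀ hfnn_pos.ne' (by linarith [h3] : 4 * (1 - Δ) * fnn = lam2 * (Δ * (V - 1) + A * S₁) * fnn)
      exact this
    rw [hA] at *
    linarith
  show S₁ / (L : ℝ) ^ 2 = 1 / ((L : ℝ) ^ 2 * lam2) - Δ / (4 * (1 - Δ) + Δ * lam2)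
  rw [← hV, ← hA]
  rw [div_eq_iff hVpos.ne', sub_mul, div_mul_eq_mul_div, div_mul_eq_mul_div]
  field_simp
  linear_combination key

end Summit.HubbardSuperconductivity.HubbardSuperconductivity.Theorems.AnisotropyChord.Transfer.Fibre3

end
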